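import Mathlib
import Summits.NavierStokesRegularity.NavierStokesRegularity.Theorems.RootDecompLitSliceFourFifthsVisibleScarClosed
import Summits.NavierStokesRegularity.NavierStokesRegularity.Theorems.RootDecompLitSliceSupRateClockScarLaw
import HarnessLib

/-!
# Route RootDecompLitSlice — cell Uᶜ `CritTameScarIsCritical` (stmt-NavierStokesRegularity-31733):
# the UNIFORM clock→scar law and CLOCK RIGIDITY under parabolic energy concentration

Helpers toward the Tao-vacuous cell Uᶜ (`--supports 31733`; no item, no node, no registered stub).

* `ClockScarLaw.uniformClockScarRung` (`0 < b ≤ 2`) — the landed clock→scar transfer law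
  `ClockScarLaw.clockScarRung` (`α(b) = 4b/(b+2)`) with the constants UNIFORM in the centre:
  `∃ C r₁, ∀ x₀, ∀ r ∈ (0,r₁), ∫_{B_r(x₀)}|u(T)|² ≤ C r^{4b/(b+2)}`. (The landed proof's constants
  `C = 2K' + 8‖u₀‖₂√K'/ν`, `r₁ = min 1 (min (T−T₁) T)` never depended on `x₀`; verbatim port with
  the quantifier moved.) A uniform super-critical scar law (`α > 1`) says: the terminal MORREY-type
  quantity `sup_{x₀} r^{-1}∫_{B_r(x₀)}|u(T)|²` tends to `0` as `r → 0`.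

* `ClockRigidity.false_of_concentration_of_uniformScar_of_clock` — the pure ENDGAME: on any family of
  `L²` slices `u(t)`, `t ∈ [0,T]`, the three statements (i) PARABOLIC ENERGY CONCENTRATION near `T`
  («`ε√(T−t) ≤ ∫_{B(x(t), √((T−t)/S₀))}|u(t)|²` for `t` near `T`», the shape of
  Kang–Miura–Tsai 2021, Thm 1.6(i) = Bradshaw–Tsai 2020), (ii) a UNIFORM scar law of order `α > 1`
  for `u(T)`, (iii) a clock `∫|u(t)−u(T)|² ≤ K(T−t)^b` with `b > 1/2`, are INCOMPATIBLE: by the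
  approximation principle `SupRateClockScarLaw.scar_le_two_clock_add_two_localMass` (roles of the
  slices swapped) `ε√S₀·ρ ≤ 2C'ρ^α + 2K'S₀^b ρ^{2b}` along `T − t = S₀ρ²`, and the right side is
  `o(ρ)`.

* `ClockRigidity.noClockAboveTwoThirds_of_concentration` — on the classical Leray–Hopf frame,
  parabolic energy concentration near `T` EXCLUDES every clock of exponent `b > 2/3`
  (`α(b) = 4b/(b+2) > 1 ⟺ b > 2/3`; `b > 2` is first reduced to `b = 2`);
  `ClockRigidity.clockExponent_le_twoThirds_of_concentration` — the same on U's maximal-smooth frame: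
  every clock exponent of a first blow-up with parabolic energy concentration is `≤ 2/3`.

READING (conditional sharpening of the landed clock cap `EnergyClockScarLaw.no_clock_above_one`,
`b ≤ 1` from Leray's floor). IN PRINT hypothesis (i) holds at EVERY first blow-up time of a local
energy solution: Kang–Miura–Tsai, *Pure Appl. Anal.* 3 (2021) 567–594, Thm 1.6(i) (arXiv:2006.13145,
p. 5: «there exist `S₀ > 0` and `x(t)` for `t ∈ (0,T_*)` such that
`(T_*−t)^{−1/2}∫_{B_{√((T_*−t)/S₀)}(x(t))}|v(t)|² > ε_*`», `T_*` the maximal time with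
`v ∈ C((0,T_*);L^∞)`; Remark 1.7: a restatement of Bradshaw–Tsai 2020). DISCHARGE OBLIGATION (not
done here, docstring duty per critic row 665 (c4)): (a) the fact is NOT yet typed in `Literature`
(nearest: `IsLocalEnergySolutionOn`, Barker–Prange 2020 layer facts); (b) the frame bridge «maximal
smooth solution from a rapidly decaying datum, Leray–Hopf on `[0,T]` ⟹ local energy solution on
`(0,T)` whose `C_tL^∞` maximal time is `T`» needs the ℝ³ pressure representation for classical
finite-energy solutions (the same missing fact as row 665 (c3)). Our typed shape of (i) is WEAKER than
print (`∃ T₀ < T` instead of all `t ∈ (0,T)`, `≤` instead of `>`), so print ⟹ typed.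

CONSEQUENCE FOR THE CELL MAP (conditional on (a)+(b)): at a first blow-up the clock exponent lies in
`(0, 2/3]` (was `(0,1]`), so the cell Uᶜ (`b ≥ 1/2`) is carried entirely by the window
`b ∈ [1/2, 2/3]`, `α(b) ∈ [4/5, 1]`; the abrupt cell Uᵃ (`b < 1/2`, Tao's habitat, `b ≈ 0.008`) is
untouched — concentration is a LOWER bound and Tao's cascade satisfies it with margin.

HONEST FRAMING: helper lemmas INSIDE the Tao-vacuous cell Uᶜ; zero load of the route moves
(ROOT ⟺ U ∧ P1, critic rows 354/371/563/639/665); no item is re-typed. Rung 0: nothing here proves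
NS regularity. Decomp-ns route-writer g39. [folklore]
-/

set_option linter.dupNamespace false

namespace Summit.NavierStokesRegularity.NavierStokesRegularity.Theorems

open MeasureTheory Set Metric Filter Topology
open scoped ENNReal
open Literature.Analysis.FluidPDE

namespace ClockScarLaw

/-- ★ **UNIFORM clock→scar transfer law `α(b) = 4b/(b+2)`** (`0 < b ≤ 2`) on the classical
Leray–Hopf frame: clock `∫|u(t)−u(T)|² ≤ K(T−t)^b` near `T` ⟹ ONE pair `(C, r₁)` with
`∫_{B_r(x₀)}|u(T)|² ≤ C r^{4b/(b+2)}` for all `r ∈ (0,r₁)` and ALL centres `x₀`. Verbatim port of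
`clockScarRung` (free-window trade-off `generalWindowTradeoff`, `τ = r^{4/(b+2)}`, `H = max K 1 · τ^b`)
with the centre quantifier moved inside. [folklore] -/
theorem uniformClockScarRung {b : ℝ} (hb : 0 < b) (hb2 : b ≤ 2) :
    ∀ (ν T : ℝ), 0 < ν → 0 < T →
    ∀ (u : ℝ → EuclideanSpace ℝ (Fin 3) → EuclideanSpace ℝ (Fin 3))
      (p : ℝ → EuclideanSpace ℝ (Fin 3) → ℝ),
      Literature.Analysis.FluidPDE.IsClassicalNSSolutionOn (Set.Ico 0 T) ν 0 u p →
      Literature.Analysis.FluidPDE.IsLerayHopfOn T ν 0 (u 0) u →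
      Literature.Analysis.FluidPDE.HasRapidSpatialDecay (u 0) →
      (∃ K T₁ : ℝ, T₁ < T ∧ ∀ t ∈ Set.Ioo T₁ T,
        ∫⁻ x, ‖u t x - u T x‖ₑ ^ 2 ≤ ENNReal.ofReal (K * (T - t) ^ b)) →
      ∃ C r₁ : ℝ, 0 < r₁ ∧ ∀ x₀ : EuclideanSpace ℝ (Fin 3), ∀ r ∈ Set.Ioo 0 r₁,
        ∫ x in Metric.ball x₀ r, ‖u T x‖ ^ 2 ≤ C * r ^ (4 * b / (b + 2)) := by
  intro ν T hν hT u p hcl hLH hdec hclock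
  obtain ⟨K, T₁, hT₁, hK⟩ := hclock
  obtain ⟨K', hK'def⟩ : ∃ K' : ℝ, K' = max K 1 := ⟨_, rfl⟩
  have hK'pos : 0 < K' := by rw [hK'def]; exact lt_of_lt_of_le one_pos (le_max_right _ _)
  have hKK' : K ≤ K' := by rw [hK'def]; exact le_max_left _ _
  have hb2pos : 0 < b + 2 := by linarith
  obtain ⟨e, hedef⟩ : ∃ e : ℝ, e = 4 / (b + 2) := ⟨_, rfl⟩
  have he1 : 1 ≤ e := by
    rw [hedef, le_div_iff₀ hb2pos]; linarith
  obtain ⟨δ, hδdef⟩ : ∃ δ : ℝ, δ = min 1 (min (T - T₁) T) := ⟨_, rfl⟩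
  have hδpos : 0 < δ := by
    rw [hδdef]; exact lt_min one_pos (lt_min (sub_pos.mpr hT₁) hT)
  refine ⟨2 * K' + 8 * Real.sqrt (∫ x, ‖u 0 x‖ ^ 2) / ν * Real.sqrt K', δ, hδpos, ?_⟩
  intro x₀ r hr
  have hr0 : 0 < r := hr.1
  have hrδ : r < δ := hr.2
  have hr1 : r ≤ 1 := hrδ.le.trans (by rw [hδdef]; exact min_le_left _ _)
  have hrT₁ : r < T - T₁ :=
    lt_of_lt_of_le hrδ (by rw [hδdef]; exact (min_le_right _ _).trans (min_le_left _ _))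
  have hrT : r < T :=
    lt_of_lt_of_le hrδ (by rw [hδdef]; exact (min_le_right _ _).trans (min_le_right _ _))
  -- the window
  obtain ⟨τ, hτdef⟩ : ∃ τ : ℝ, τ = r ^ e := ⟨_, rfl⟩
  have hτpos : 0 < τ := by rw [hτdef]; exact Real.rpow_pos_of_pos hr0 e
  have hτler : τ ≤ r := by
    have h1 := Real.rpow_le_rpow_of_exponent_ge hr0 hr1 he1
    rw [Real.rpow_one] at h1
    rw [hτdef]; exact h1
  have hτT : τ < T := lt_of_le_of_lt hτler hrT
  have hτT₁ : τ < T - T₁ := lt_of_le_of_lt hτler hrT₁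
  -- the modulus level
  obtain ⟨H, hHdef⟩ : ∃ H : ℝ, H = K' * τ ^ b := ⟨_, rfl⟩
  have hτb : 0 ≤ τ ^ b := Real.rpow_nonneg hτpos.le b
  have hH : 0 ≤ H := by rw [hHdef]; exact mul_nonneg hK'pos.le hτb
  have hmod : ∀ t ∈ Set.Ico (T - τ) T,
      ∫⁻ x, ‖u t x - u T x‖ₑ ^ 2 ≤ ENNReal.ofReal H := by
    intro t ht
    have ht1 : T₁ < t := by linarith [ht.1]
    refine (hK t ⟨ht1, ht.2⟩).trans (ENNReal.ofReal_le_ofReal ?_)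
    have h0 : 0 ≤ T - t := by linarith [ht.2]
    have h1 : T - t ≤ τ := by linarith [ht.1]
    have hpow : (T - t) ^ b ≤ τ ^ b := Real.rpow_le_rpow h0 h1 hb.le
    rw [hHdef]
    calc K * (T - t) ^ b ≤ K' * (T - t) ^ b :=
          mul_le_mul_of_nonneg_right hKK' (Real.rpow_nonneg h0 b)
      _ ≤ K' * τ ^ b := mul_le_mul_of_nonneg_left hpow hK'pos.le
  have hmain := generalWindowTradeoff ν T hν hT u p hcl hLH hdec x₀ r τ H hr0 hτpos hτT hH hmod
  -- exponent bookkeeping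
  have hexp1 : τ ^ b = r ^ (4 * b / (b + 2)) := by
    rw [hτdef, ← Real.rpow_mul hr0.le]
    congr 1
    rw [hedef]; field_simp
  have hexp2 : Real.sqrt (r ^ (4 * b / (b + 2))) = r ^ (2 * b / (b + 2)) := by
    rw [Real.sqrt_eq_rpow, ← Real.rpow_mul hr0.le]
    congr 1
    field_simp; ring
  have hexp3 : r ^ 2 / τ = r ^ (2 * b / (b + 2)) := by
    rw [hτdef, ← Real.rpow_two, ← Real.rpow_sub hr0]
    congr 1
    rw [hedef]; field_simp; ring
  have hexp4 : r ^ (2 * b / (b + 2)) * r ^ (2 * b / (b + 2)) = r ^ (4 * b / (b + 2)) := by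
    rw [← Real.rpow_add hr0]
    congr 1; ring
  have hsqrtH : Real.sqrt H = Real.sqrt K' * r ^ (2 * b / (b + 2)) := by
    rw [hHdef, Real.sqrt_mul hK'pos.le, hexp1, hexp2]
  refine hmain.trans (le_of_eq ?_)
  rw [hsqrtH, hexp3, hHdef, hexp1]
  generalize Real.sqrt (∫ x, ‖u 0 x‖ ^ 2) = S
  generalize hX : r ^ (4 * b / (b + 2)) = X
  generalize hY : r ^ (2 * b / (b + 2)) = Y
  rw [hX, hY] at hexp4
  calc 2 * (K' * X) + 8 * S / ν * Y * (Real.sqrt K' * Y)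
      = 2 * (K' * X) + 8 * S / ν * Real.sqrt K' * (Y * Y) := by ring
    _ = (2 * K' + 8 * S / ν * Real.sqrt K') * X := by rw [hexp4]; ring

/-- The uniform super-critical law kills the terminal Morrey quantity uniformly: if `α > 1` then
`r⁻¹ ∫_{B_r(x₀)}|u(T)|² ≤ max C 0 · r^{α−1}` for all centres and all `r ∈ (0, min r₁ 1)`
(bookkeeping corollary; `r^{α−1} → 0`). [folklore] -/
theorem morreyQuotient_le_of_uniformScar {u : ℝ → EuclideanSpace ℝ (Fin 3) → EuclideanSpace ℝ (Fin 3)}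
    {T α C r₁ : ℝ}
    (hC : ∀ x₀ : EuclideanSpace ℝ (Fin 3), ∀ r ∈ Set.Ioo 0 r₁,
      ∫ x in Metric.ball x₀ r, ‖u T x‖ ^ 2 ≤ C * r ^ α) :
    ∀ x₀ : EuclideanSpace ℝ (Fin 3), ∀ r ∈ Set.Ioo 0 r₁,
      r⁻¹ * ∫ x in Metric.ball x₀ r, ‖u T x‖ ^ 2 ≤ max C 0 * r ^ (α - 1) := by
  intro x₀ r hr
  have hr0 : 0 < r := hr.1
  have h1 := hC x₀ r hr
  have h2 : C * r ^ α ≤ max C 0 * r ^ α :=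
    mul_le_mul_of_nonneg_right (le_max_left _ _) (Real.rpow_nonneg hr0.le _)
  rw [inv_mul_le_iff₀ hr0]
  have h3 : r * (max C 0 * r ^ (α - 1)) = max C 0 * r ^ α := by
    rw [Real.rpow_sub_one hr0.ne', mul_left_comm, ← mul_div_assoc, mul_div_cancel_left₀ _ hr0.ne']
  rw [h3]
  exact h1.trans h2

end ClockScarLaw

namespace ClockRigidity

/-- ★ **The endgame (pure): parabolic energy concentration, a uniform super-critical scar law and a
super-√ clock are incompatible.** For `L²` slices `u(t)`, `t ∈ [0,T]` (`T > 0`): if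
(i) `ε√(T−t) ≤ ∫_{B(x(t),√((T−t)/S₀))}|u(t)|²` for `t ∈ (T₀,T)` (`ε, S₀ > 0`; the Kang–Miura–Tsai
2021 Thm 1.6(i) / Bradshaw–Tsai 2020 shape), (ii) `∫_{B_r(x₀)}|u(T)|² ≤ C r^α` for all `x₀` and
`r ∈ (0,r₁)` with `α > 1`, and (iii) `∫|u(t)−u(T)|² ≤ K(T−t)^b` on `(T₁,T)` with `b > 1/2`, then
`False`: along `T − t = S₀ρ²` the approximation principle gives `ε√S₀·ρ ≤ 2C'ρ^α + 2K'S₀^bρ^{2b}`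
(`C' = max C 0`, `K' = max K 0`), i.e. `ε√S₀ ≤ 2C'ρ^{α−1} + 2K'S₀^bρ^{2b−1} → 0`. [folklore] -/
theorem false_of_concentration_of_uniformScar_of_clock {T : ℝ} (hT : 0 < T)
    (u : ℝ → EuclideanSpace ℝ (Fin 3) → EuclideanSpace ℝ (Fin 3))
    (hmem : ∀ t ∈ Set.Icc 0 T, MemLp (u t) 2 volume)
    {α : ℝ} (hα : 1 < α)
    (hscar : ∃ C r₁ : ℝ, 0 < r₁ ∧ ∀ x₀ : EuclideanSpace ℝ (Fin 3), ∀ r ∈ Set.Ioo 0 r₁,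
      ∫ x in Metric.ball x₀ r, ‖u T x‖ ^ 2 ≤ C * r ^ α)
    {b : ℝ} (hb : 1 / 2 < b)
    (hclock : ∃ K T₁ : ℝ, T₁ < T ∧ ∀ t ∈ Set.Ioo T₁ T,
      ∫⁻ x, ‖u t x - u T x‖ₑ ^ 2 ≤ ENNReal.ofReal (K * (T - t) ^ b))
    (hconc : ∃ ε S₀ T₀ : ℝ, 0 < ε ∧ 0 < S₀ ∧ T₀ < T ∧ ∀ t ∈ Set.Ioo T₀ T,
      ∃ x : EuclideanSpace ℝ (Fin 3), ε * Real.sqrt (T - t) ≤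
        ∫ y in Metric.ball x (Real.sqrt ((T - t) / S₀)), ‖u t y‖ ^ 2) :
    False := by
  obtain ⟨C, r₁, hr₁, hC⟩ := hscar
  obtain ⟨K, T₁, hT₁, hK⟩ := hclock
  obtain ⟨ε, S₀, T₀, hε, hS₀, hT₀, hconc⟩ := hconc
  -- nonnegative versions of the constants
  obtain ⟨C', hC'def⟩ : ∃ C' : ℝ, C' = max C 0 := ⟨_, rfl⟩
  obtain ⟨K', hK'def⟩ : ∃ K' : ℝ, K' = max K 0 := ⟨_, rfl⟩
  have hC'0 : 0 ≤ C' := by rw [hC'def]; exact le_max_right _ _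
  have hK'0 : 0 ≤ K' := by rw [hK'def]; exact le_max_right _ _
  have hCC' : C ≤ C' := by rw [hC'def]; exact le_max_left _ _
  have hKK' : K ≤ K' := by rw [hK'def]; exact le_max_left _ _
  have hεS : 0 < ε * Real.sqrt S₀ := mul_pos hε (Real.sqrt_pos.mpr hS₀)
  -- the defect `2C'ρ^(α-1) + 2K'S₀^b ρ^(2b-1)` tends to `0` as `ρ → 0`
  have hne1 : α - 1 ≠ 0 := by linarith
  have hne2 : 2 * b - 1 ≠ 0 := by linarith
  have hlim : Tendsto (fun ρ : ℝ => 2 * C' * ρ ^ (α - 1) + 2 * (K' * S₀ ^ b) * ρ ^ (2 * b - 1))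
      (𝓝 0) (𝓝 (2 * C' * (0 : ℝ) ^ (α - 1) + 2 * (K' * S₀ ^ b) * (0 : ℝ) ^ (2 * b - 1))) := by
    have h1 : ContinuousAt (fun ρ : ℝ => ρ ^ (α - 1)) 0 :=
      Real.continuousAt_rpow_const 0 (α - 1) (Or.inr (by linarith))
    have h2 : ContinuousAt (fun ρ : ℝ => ρ ^ (2 * b - 1)) 0 :=
      Real.continuousAt_rpow_const 0 (2 * b - 1) (Or.inr (by linarith))
    exact (h1.tendsto.const_mul (2 * C')).add (h2.tendsto.const_mul (2 * (K' * S₀ ^ b)))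
  rw [Real.zero_rpow hne1, Real.zero_rpow hne2, mul_zero, mul_zero, add_zero] at hlim
  -- thresholds: `ρ < r₁`, `ρ ≤ 1`, `S₀ρ < smin`
  obtain ⟨smin, hsmindef⟩ : ∃ smin : ℝ, smin = min (T - T₀) (min (T - T₁) T) := ⟨_, rfl⟩
  have hsmin0 : 0 < smin := by
    rw [hsmindef]; exact lt_min (sub_pos.mpr hT₀) (lt_min (sub_pos.mpr hT₁) hT)
  obtain ⟨ρ₁, hρ₁def⟩ : ∃ ρ₁ : ℝ, ρ₁ = min r₁ (min 1 (smin / S₀)) := ⟨_, rfl⟩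
  have hρ₁0 : 0 < ρ₁ := by
    rw [hρ₁def]; exact lt_min hr₁ (lt_min one_pos (div_pos hsmin0 hS₀))
  have hev1 : ∀ᶠ ρ in 𝓝[>] (0 : ℝ), ρ ∈ Set.Ioo 0 ρ₁ := Ioo_mem_nhdsGT hρ₁0
  have hev2 : ∀ᶠ ρ in 𝓝[>] (0 : ℝ),
      2 * C' * ρ ^ (α - 1) + 2 * (K' * S₀ ^ b) * ρ ^ (2 * b - 1) < ε * Real.sqrt S₀ :=
    nhdsWithin_le_nhds (hlim.eventually (eventually_lt_nhds hεS))
  obtain ⟨ρ, ⟨hρ0, hρ1⟩, hgρ⟩ := (hev1.and hev2).exists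
  have hρr₁ : ρ < r₁ := lt_of_lt_of_le hρ1 (by rw [hρ₁def]; exact min_le_left _ _)
  have hρle1 : ρ ≤ 1 :=
    (lt_of_lt_of_le hρ1 (by rw [hρ₁def]; exact (min_le_right _ _).trans (min_le_left _ _))).le
  have hρs : ρ < smin / S₀ :=
    lt_of_lt_of_le hρ1 (by rw [hρ₁def]; exact (min_le_right _ _).trans (min_le_right _ _))
  -- the time `t = T − S₀ρ²`
  obtain ⟨s, hsdef⟩ : ∃ s : ℝ, s = S₀ * ρ ^ 2 := ⟨_, rfl⟩
  have hs0 : 0 < s := by rw [hsdef]; positivity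
  have hs_lt : s < smin := by
    have h1 : ρ ^ 2 ≤ ρ := by nlinarith
    have h2 : S₀ * ρ < smin := by
      have := (lt_div_iff₀ hS₀).1 hρs
      linarith [mul_comm ρ S₀]
    calc s = S₀ * ρ ^ 2 := hsdef
      _ ≤ S₀ * ρ := mul_le_mul_of_nonneg_left h1 hS₀.le
      _ < smin := h2
  obtain ⟨t, htdef⟩ : ∃ t : ℝ, t = T - s := ⟨_, rfl⟩
  have hTt : T - t = s := by rw [htdef]; ring
  have htT : t < T := by rw [htdef]; linarith
  have ht₀ : T₀ < t := by
    have : smin ≤ T - T₀ := by rw [hsmindef]; exact min_le_left _ _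
    rw [htdef]; linarith
  have ht₁ : T₁ < t := by
    have : smin ≤ T - T₁ := by rw [hsmindef]; exact (min_le_right _ _).trans (min_le_left _ _)
    rw [htdef]; linarith
  have ht0 : 0 ≤ t := by
    have : smin ≤ T := by rw [hsmindef]; exact (min_le_right _ _).trans (min_le_right _ _)
    rw [htdef]; linarith
  -- radius identities along `T − t = S₀ρ²`
  have hrad : Real.sqrt ((T - t) / S₀) = ρ := by
    rw [hTt, hsdef, mul_div_cancel_left₀ _ hS₀.ne', Real.sqrt_sq hρ0.le]
  have hsqrt_s : Real.sqrt (T - t) = Real.sqrt S₀ * ρ := by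
    rw [hTt, hsdef, Real.sqrt_mul hS₀.le, Real.sqrt_sq hρ0.le]
  -- concentration at time `t`
  obtain ⟨x, hx⟩ := hconc t ⟨ht₀, htT⟩
  rw [hrad, hsqrt_s] at hx
  -- memberships
  have hmT : MemLp (u T) 2 volume := hmem T ⟨hT.le, le_rfl⟩
  have hmt : MemLp (u t) 2 volume := hmem t ⟨ht0, htT.le⟩
  -- clock term at `t`
  have hH0 : 0 ≤ K' * s ^ b := mul_nonneg hK'0 (Real.rpow_nonneg hs0.le _)
  have hmod : ∫⁻ y, ‖u T y - u t y‖ₑ ^ 2 ≤ ENNReal.ofReal (K' * s ^ b) := by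
    have h1 : ∫⁻ y, ‖u T y - u t y‖ₑ ^ 2 = ∫⁻ y, ‖u t y - u T y‖ₑ ^ 2 := by
      refine lintegral_congr fun y => ?_
      rw [← enorm_neg, neg_sub]
    rw [h1]
    refine (hK t ⟨ht₁, htT⟩).trans (ENNReal.ofReal_le_ofReal ?_)
    rw [hTt]
    exact mul_le_mul_of_nonneg_right hKK' (Real.rpow_nonneg hs0.le _)
  -- scar term at the centre `x`
  have hB0 : 0 ≤ C' * ρ ^ α := mul_nonneg hC'0 (Real.rpow_nonneg hρ0.le _)
  have hloc : ∫ y in Metric.ball x ρ, ‖u T y‖ ^ 2 ≤ C' * ρ ^ α :=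
    (hC x ρ ⟨hρ0, hρr₁⟩).trans (mul_le_mul_of_nonneg_right hCC' (Real.rpow_nonneg hρ0.le _))
  -- approximation principle with the roles of the slices swapped
  have hmain := SupRateClockScarLaw.scar_le_two_clock_add_two_localMass (u t) (u T) hmt hmT x ρ
    hH0 hB0 hmod hloc
  -- exponent bookkeeping: `s^b = S₀^b·ρ·ρ^(2b−1)`, `ρ^α = ρ·ρ^(α−1)`
  have h1 : s ^ b = S₀ ^ b * (ρ * ρ ^ (2 * b - 1)) := by
    rw [Real.rpow_sub_one hρ0.ne', mul_div_assoc', mul_div_cancel_left₀ _ hρ0.ne', hsdef,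
      Real.mul_rpow hS₀.le (sq_nonneg ρ), ← Real.rpow_two, ← Real.rpow_mul hρ0.le]
  have h2 : ρ ^ α = ρ * ρ ^ (α - 1) := by
    rw [Real.rpow_sub_one hρ0.ne', mul_div_assoc', mul_div_cancel_left₀ _ hρ0.ne']
  have hkey : ρ * (ε * Real.sqrt S₀) ≤
      ρ * (2 * C' * ρ ^ (α - 1) + 2 * (K' * S₀ ^ b) * ρ ^ (2 * b - 1)) := by
    calc ρ * (ε * Real.sqrt S₀) = ε * (Real.sqrt S₀ * ρ) := by ring
      _ ≤ ∫ y in Metric.ball x ρ, ‖u t y‖ ^ 2 := hx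
      _ ≤ 2 * (K' * s ^ b) + 2 * (C' * ρ ^ α) := hmain
      _ = ρ * (2 * C' * ρ ^ (α - 1) + 2 * (K' * S₀ ^ b) * ρ ^ (2 * b - 1)) := by
          rw [h1, h2]; ring
  have hcontra : ε * Real.sqrt S₀ ≤
      2 * C' * ρ ^ (α - 1) + 2 * (K' * S₀ ^ b) * ρ ^ (2 * b - 1) :=
    le_of_mul_le_mul_left hkey hρ0
  linarith

/-- A clock of any exponent `b` near `T` implies the clock of exponent `min b 2` near `T`
(`(T−t)^b ≤ (T−t)^{min b 2}` once `T − t ≤ 1`; `K ↦ max K 0`). [folklore] -/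
theorem clock_min_two_of_clock {T b : ℝ}
    {u : ℝ → EuclideanSpace ℝ (Fin 3) → EuclideanSpace ℝ (Fin 3)}
    (h : ∃ K T₁ : ℝ, T₁ < T ∧ ∀ t ∈ Set.Ioo T₁ T,
      ∫⁻ x, ‖u t x - u T x‖ₑ ^ 2 ≤ ENNReal.ofReal (K * (T - t) ^ b)) :
    ∃ K T₁ : ℝ, T₁ < T ∧ ∀ t ∈ Set.Ioo T₁ T,
      ∫⁻ x, ‖u t x - u T x‖ₑ ^ 2 ≤ ENNReal.ofReal (K * (T - t) ^ (min b 2)) := by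
  obtain ⟨K, T₁, hT₁, hK⟩ := h
  refine ⟨max K 0, max T₁ (T - 1), max_lt hT₁ (by linarith), fun t ht => ?_⟩
  have ht₁ : T₁ < t := lt_of_le_of_lt (le_max_left _ _) ht.1
  have ht1 : T - 1 < t := lt_of_le_of_lt (le_max_right _ _) ht.1
  have h0 : 0 < T - t := sub_pos.mpr ht.2
  have h1 : T - t ≤ 1 := by linarith
  refine (hK t ⟨ht₁, ht.2⟩).trans (ENNReal.ofReal_le_ofReal ?_)
  have hpow : (T - t) ^ b ≤ (T - t) ^ (min b 2) :=
    Real.rpow_le_rpow_of_exponent_ge h0 h1 (min_le_left _ _)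
  calc K * (T - t) ^ b ≤ max K 0 * (T - t) ^ b :=
        mul_le_mul_of_nonneg_right (le_max_left _ _) (Real.rpow_nonneg h0.le _)
    _ ≤ max K 0 * (T - t) ^ (min b 2) := mul_le_mul_of_nonneg_left hpow (le_max_right _ _)

/-- ★ **CLOCK RIGIDITY on the classical Leray–Hopf frame**: parabolic energy concentration near `T`
(hypothesis (i), the Kang–Miura–Tsai 2021 Thm 1.6(i) shape, quantified AFTER `ν, T, u, p`) EXCLUDES
every clock `∫|u(t)−u(T)|² ≤ K(T−t)^b` of exponent `b > 2/3`: the uniform law `uniformClockScarRung`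
gives scars of order `α = 4b'/(b'+2) > 1` for `b' = min b 2 > 2/3`, and the endgame applies
(`b' > 1/2`). [folklore] -/
theorem noClockAboveTwoThirds_of_concentration {b : ℝ} (hb : 2 / 3 < b) :
    ∀ (ν T : ℝ), 0 < ν → 0 < T →
    ∀ (u : ℝ → EuclideanSpace ℝ (Fin 3) → EuclideanSpace ℝ (Fin 3))
      (p : ℝ → EuclideanSpace ℝ (Fin 3) → ℝ),
      Literature.Analysis.FluidPDE.IsClassicalNSSolutionOn (Set.Ico 0 T) ν 0 u p →
      Literature.Analysis.FluidPDE.IsLerayHopfOn T ν 0 (u 0) u →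
      Literature.Analysis.FluidPDE.HasRapidSpatialDecay (u 0) →
      (∃ ε S₀ T₀ : ℝ, 0 < ε ∧ 0 < S₀ ∧ T₀ < T ∧ ∀ t ∈ Set.Ioo T₀ T,
        ∃ x : EuclideanSpace ℝ (Fin 3), ε * Real.sqrt (T - t) ≤
          ∫ y in Metric.ball x (Real.sqrt ((T - t) / S₀)), ‖u t y‖ ^ 2) →
      ¬ (∃ K T₁ : ℝ, T₁ < T ∧ ∀ t ∈ Set.Ioo T₁ T,
        ∫⁻ x, ‖u t x - u T x‖ₑ ^ 2 ≤ ENNReal.ofReal (K * (T - t) ^ b)) := by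
  intro ν T hν hT u p hcl hLH hdec hconc hclock
  have hclock' := clock_min_two_of_clock hclock
  have hb' : 0 < min b 2 := lt_min (by linarith) two_pos
  have hb'2 : min b 2 ≤ 2 := min_le_right _ _
  have hb'gt : 2 / 3 < min b 2 := lt_min hb (by norm_num)
  obtain ⟨C, r₁, hr₁, hC⟩ :=
    ClockScarLaw.uniformClockScarRung hb' hb'2 ν T hν hT u p hcl hLH hdec hclock'
  have hα : 1 < 4 * min b 2 / (min b 2 + 2) := by
    rw [lt_div_iff₀ (by linarith)]; linarith
  exact false_of_concentration_of_uniformScar_of_clock hT u hLH.memLp hα ⟨C, r₁, hr₁, hC⟩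
    (b := min b 2) (by linarith) hclock' hconc

/-- ★ **On U's maximal-smooth frame: every clock exponent of a first blow-up with parabolic energy
concentration is `≤ 2/3`.** (Frame of U/Uᶜ/Uᵃ: maximal smooth solution, Leray–Hopf on `[0,T]`,
rapidly decaying datum; the concentration hypothesis is Kang–Miura–Tsai 2021 Thm 1.6(i) read on this
frame — in print it holds at every such `T`; its discharge needs the typed fact and the frame bridge,
see the module docstring.) Conditional sharpening of `EnergyClockScarLaw.no_clock_above_one`
(`b ≤ 1`). [folklore] -/
theorem clockExponent_le_twoThirds_of_concentration :
    ∀ (ν T : ℝ), 0 < ν → 0 < T →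
    ∀ (u : ℝ → EuclideanSpace ℝ (Fin 3) → EuclideanSpace ℝ (Fin 3))
      (p : ℝ → EuclideanSpace ℝ (Fin 3) → ℝ),
      Literature.Analysis.FluidPDE.IsMaximalSmoothSolution ν 0 u p T →
      Literature.Analysis.FluidPDE.IsLerayHopfOn T ν 0 (u 0) u →
      Literature.Analysis.FluidPDE.HasRapidSpatialDecay (u 0) →
      (∃ ε S₀ T₀ : ℝ, 0 < ε ∧ 0 < S₀ ∧ T₀ < T ∧ ∀ t ∈ Set.Ioo T₀ T,
        ∃ x : EuclideanSpace ℝ (Fin 3), ε * Real.sqrt (T - t) ≤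
          ∫ y in Metric.ball x (Real.sqrt ((T - t) / S₀)), ‖u t y‖ ^ 2) →
      ∀ b : ℝ, (∃ K T₁ : ℝ, T₁ < T ∧ ∀ t ∈ Set.Ioo T₁ T,
        ∫⁻ x, ‖u t x - u T x‖ₑ ^ 2 ≤ ENNReal.ofReal (K * (T - t) ^ b)) → b ≤ 2 / 3 := by
  intro ν T hν hT u p hmax hLH hdec hconc b hclock
  by_contra h
  exact noClockAboveTwoThirds_of_concentration (not_le.mp h) ν T hν hT u p hmax.1 hLH hdec hconc
    hclock

end ClockRigidity

end Summit.NavierStokesRegularity.NavierStokesRegularity.Theorems
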